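import Summits.QuantumFields.YangMills.Theorems.BalabanLadderIRcofCentreFinite
import Summits.QuantumFields.YangMills.Theorems.EquipartitionCriticalityFreeEnergyLogCoefficientStubWeakCoupling
import HarnessLib

/-!
# Crux `CentreWallReflection.NegligibleWalls` ⟨stmt-QuantumFields-23706⟩, line `birth` (planner ym-idea-4 g18, LINE g18-A): the registered
# stub `stub_datum` — CLOSED (an admissible wall datum: the nearest-central-element label)

`WallDatumP`: for every compact simple `G` with non-trivial centre and every faithful unitary lattice representation `r` there are a central
`z` and a measurable class-function label `O : G → ℕ` such that for every thinness `τ > 0` there is an admissible wall `(W, δ, η)`: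
`W` measurable and conjugation-invariant, `O(zg) ≠ O(g)` off `W`, `O` locally constant off `W` at trace scale `δ`, and `W` trace-separated
from the WHOLE centre by `η > 0`.

Construction (the thinness `τ` does not constrain `W` in the registered statement, so ONE datum serves every `τ`).  The centre `Z(G)` is FINITE
(tree ✓`Cruxes.IRcof.CentreFinite.finite_center_of_isCompactSimpleLieGroup`, Bröcker–tom Dieck V (7.13)); `ρ = r.ρ` is injective, so the
finitely many matrices `ρ(c)`, `c ∈ Z(G)`, are pairwise at Frobenius distance `≥ s > 0`.  Put `θ = s/4` and
* `O(g) = Σ_{c ∈ Z(G)} idx(c)·𝟙[‖ρ g − ρ c‖ < θ]` (`idx` an injective enumeration of `Z(G)` by positive integers): the index of THE central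
  element `θ`-close to `ρ(g)` (unique by the triangle inequality), `0` if there is none;
* `W = {g | ∀ c ∈ Z(G), η ≤ r.N − Re tr ρ(c⁻¹g)}` with `η = δ = θ²/2`, i.e. (`r.N − Re tr ρ(c⁻¹ g) = ½‖ρ g − ρ c‖²` for unitary `ρ`) the
  complement of the `θ`-neighbourhood of the centre.
Then: `O` and `W` are conjugation invariant (`‖ρ(hgh⁻¹) − ρ c‖ = ‖ρ g − ρ c‖` for central `c`, unitary invariance of the Frobenius norm);
off `W`, `g` is `θ`-close to a unique central `c₀`, `zg` is `θ`-close to `zc₀ ≠ c₀` (pick `z ≠ 1` in `Z(G) ≠ ⊥`), so `O(zg) = idx(zc₀) ≠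
idx(c₀) = O(g)`; if moreover `g'` is off `W` and `r.N − Re tr ρ(g⁻¹g') < δ`, i.e. `‖ρ g' − ρ g‖ < θ`, the central elements close to `g` and
`g'` are within `3θ < s`, hence equal, so `O g = O g'`; and `W` is `η`-separated from the centre by definition.
HONEST FRAMING: the representation-theoretic (M) stub only; the Laplace-type stub `stub_conc` (centre concentration of one Polyakov holonomy at
fixed torus), the crux `NegligibleWalls`, the route's target and the Yang–Mills mass gap are NOT proved here.  No `sorry`, no new axiom; the
`abbrev` is a registered-stub copy (verbatim), not a citable fact.  References: [cite: BrockerTomDieck1985, V (7.13)];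
[cite: HornJohnson2013, Thm 2.2.2]; [cite: tHooft1979].
-/

set_option autoImplicit false

noncomputable section

open scoped Matrix.Norms.Frobenius BigOperators
open MeasureTheory
open Literature.MathematicalPhysics.QuantumFieldTheory

namespace Summit.QuantumFields.YangMills.Theorems.CentreWallReflection

/-! ## §1 The registered stub statement (verbatim copy of the skeleton's `WallDatumP`) -/

/-- STUB statement `WallDatumP` of the birth skeleton of crux ⟨stmt-QuantumFields-23706⟩ (verbatim copy of
`CentreWallReflectionBirth.WallDatumP`; a registered-stub copy, not a citable fact): an admissible wall datum for some central `z`. -/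
abbrev WallDatumP : Prop :=
  open MeasureTheory Filter Literature.MathematicalPhysics.QuantumFieldTheory in
  ∀ (G : Type) [Group G] [TopologicalSpace G] [IsTopologicalGroup G] [CompactSpace G],
    IsCompactSimpleLieGroup G → Subgroup.center G ≠ ⊥ →
    letI : MeasurableSpace G := borel G
    haveI : BorelSpace G := ⟨rfl⟩
    ∀ r : LatticeRep G, ∃ z ∈ Subgroup.center G, ∃ (O : G → ℕ), ∀ τ : ℝ, 0 < τ →
      ∃ (W : Set G) (δ η : ℝ),
        Measurable O ∧ MeasurableSet W ∧
        (∀ g h : G, O (h * g * h⁻¹) = O g) ∧ (∀ g h : G, h * g * h⁻¹ ∈ W ↔ g ∈ W) ∧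
        (∀ g : G, g ∉ W → O (z * g) ≠ O g) ∧ 0 < δ ∧
        (∀ g g' : G, (r.N : ℝ) - (r.ρ (g⁻¹ * g')).trace.re < δ → g ∉ W → g' ∉ W → O g = O g') ∧
        0 < η ∧ (∀ c ∈ Subgroup.center G, ∀ g ∈ W, η ≤ (r.N : ℝ) - (r.ρ (c⁻¹ * g)).trace.re)

/-! ## §2 Frobenius-norm algebra for a unitary representation -/

section Algebra

variable {G : Type*} [Group G] {N : ℕ} (ρ : G →* Matrix (Fin N) (Fin N) ℂ)
  (hU : ∀ g, ρ g ∈ Matrix.unitaryGroup (Fin N) ℂ)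

include hU in
/-- `‖ρ g − ρ c‖ = ‖ρ(c⁻¹g) − 1‖` (left unitary invariance of the Frobenius norm). [cite: HornJohnson2013, Thm 2.2.2] -/
theorem norm_rho_sub_rho_eq (g c : G) : ‖ρ g - ρ c‖ = ‖ρ (c⁻¹ * g) - 1‖ := by
  have hV : ρ c⁻¹ * ρ c = 1 := by rw [← map_mul, inv_mul_cancel, map_one]
  have e : ρ (c⁻¹ * g) - 1 = ρ c⁻¹ * (ρ g - ρ c) := by rw [Matrix.mul_sub, hV, map_mul]
  rw [e, Matrix.frobenius_norm_unitaryGroup_mul ⟨ρ c⁻¹, hU c⁻¹⟩]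

include hU in
/-- The trace distance is half the squared Frobenius distance: `N − Re tr ρ(c⁻¹g) = ½‖ρ g − ρ c‖²`. [cite: HornJohnson2013, Thm 2.2.2] -/
theorem traceDist_eq (c g : G) : (N : ℝ) - (ρ (c⁻¹ * g)).trace.re = ‖ρ g - ρ c‖ ^ 2 / 2 := by
  rw [FreeEnergyLogCoefficient.WeakCoupling.sub_re_trace_eq ρ hU (c⁻¹ * g), norm_rho_sub_rho_eq ρ hU g c, norm_sub_rev]

include hU in
/-- Conjugation invariance of the distance to a CENTRAL element: `‖ρ(hgh⁻¹) − ρ c‖ = ‖ρ g − ρ c‖` for `c ∈ Z(G)`.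
[cite: HornJohnson2013, Thm 2.2.2] -/
theorem norm_rho_conj_sub_central (c : G) (hc : c ∈ Subgroup.center G) (g h : G) :
    ‖ρ (h * g * h⁻¹) - ρ c‖ = ‖ρ g - ρ c‖ := by
  have hc' : h * c * h⁻¹ = c := by
    rw [Subgroup.mem_center_iff.mp hc h, mul_inv_cancel_right]
  have e : ρ (h * g * h⁻¹) - ρ c = ρ h * (ρ g - ρ c) * ρ h⁻¹ := by
    conv_lhs => rw [← hc']
    rw [map_mul, map_mul, map_mul, map_mul, Matrix.mul_sub, Matrix.sub_mul]
  rw [e, Matrix.frobenius_norm_mul_unitaryGroup _ ⟨ρ h⁻¹, hU h⁻¹⟩, Matrix.frobenius_norm_unitaryGroup_mul ⟨ρ h, hU h⟩]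

include hU in
/-- Left translation invariance: `‖ρ(zg) − ρ(zc)‖ = ‖ρ g − ρ c‖`. [cite: HornJohnson2013, Thm 2.2.2] -/
theorem norm_rho_mul_sub_mul (z g c : G) : ‖ρ (z * g) - ρ (z * c)‖ = ‖ρ g - ρ c‖ := by
  rw [map_mul, map_mul, ← Matrix.mul_sub, Matrix.frobenius_norm_unitaryGroup_mul ⟨ρ z, hU z⟩]

end Algebra

/-! ## §3 The stub, by name -/

/-- ★★ **`stub_datum`** (registered stub of the birth skeleton of crux ⟨stmt-QuantumFields-23706⟩, signature `WallDatumP` verbatim): an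
admissible wall datum exists — the nearest-central-element label `O` and the complement `W` of the `θ`-neighbourhood of the (finite) centre,
`θ` a quarter of the minimal Frobenius distance between the images of distinct central elements, `δ = η = θ²/2`.
[cite: BrockerTomDieck1985, V (7.13)] [cite: HornJohnson2013, Thm 2.2.2] -/
theorem stub_datum : WallDatumP := by
  intro G _ _ _ _ hG hZ
  letI : MeasurableSpace G := borel G
  haveI : BorelSpace G := ⟨rfl⟩
  intro r
  classical
  -- the finite centre, as a finset
  haveI hfinZ : Finite (Subgroup.center G) := Cruxes.IRcof.CentreFinite.finite_center_of_isCompactSimpleLieGroup hG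
  have hSfin : (Subgroup.center G : Set G).Finite := Set.toFinite _
  set S : Finset G := hSfin.toFinset with hSdef
  have hS : ∀ c : G, c ∈ S ↔ c ∈ Subgroup.center G := fun c => by
    rw [hSdef, Set.Finite.mem_toFinset]; rfl
  -- a non-trivial central element
  obtain ⟨z, hz, hz1⟩ : ∃ z ∈ Subgroup.center G, z ≠ 1 := by
    obtain ⟨x, hx⟩ := (Subgroup.ne_bot_iff_exists_ne_one).mp hZ
    exact ⟨x.1, x.2, fun h1 => hx (Subtype.ext h1)⟩
  -- the separation of the images of distinct central elements
  set ρ := r.ρ with hρ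
  have hU := r.mem_unitary
  set P : Finset (G × G) := (S ×ˢ S).filter (fun p => p.1 ≠ p.2) with hPdef
  have hPne : P.Nonempty := ⟨(1, z), by
    rw [hPdef, Finset.mem_filter, Finset.mem_product, hS, hS]
    exact ⟨⟨Subgroup.one_mem _, hz⟩, fun h => hz1 h.symm⟩⟩
  obtain ⟨p₀, hp₀, hmin⟩ := Finset.exists_min_image P (fun p => ‖ρ p.1 - ρ p.2‖) hPne
  set s : ℝ := ‖ρ p₀.1 - ρ p₀.2‖ with hsdef
  have hs0 : 0 < s := by
    have hne : p₀.1 ≠ p₀.2 := by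
      rw [hPdef, Finset.mem_filter] at hp₀; exact hp₀.2
    have : ρ p₀.1 ≠ ρ p₀.2 := fun h => hne (r.injective h)
    exact norm_pos_iff.mpr (sub_ne_zero.mpr this)
  have hsep : ∀ c c' : G, c ∈ Subgroup.center G → c' ∈ Subgroup.center G → c ≠ c' → s ≤ ‖ρ c - ρ c'‖ := by
    intro c c' hc hc' hne
    have hmem : (c, c') ∈ P := by
      rw [hPdef, Finset.mem_filter, Finset.mem_product, hS, hS]; exact ⟨⟨hc, hc'⟩, hne⟩
    exact hmin (c, c') hmem
  -- the radius and the scales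
  set θ : ℝ := s / 4 with hθ
  have hθ0 : 0 < θ := by positivity
  -- uniqueness of the close central element
  have huniq : ∀ (x c c' : G), c ∈ Subgroup.center G → c' ∈ Subgroup.center G →
      ‖ρ x - ρ c‖ < 2 * θ → ‖ρ x - ρ c'‖ < 2 * θ → c = c' := by
    intro x c c' hc hc' h1 h2
    by_contra hne
    have htri : ‖ρ c - ρ c'‖ ≤ ‖ρ x - ρ c‖ + ‖ρ x - ρ c'‖ := by
      rw [← norm_neg (ρ x - ρ c), neg_sub]
      have e : ρ c - ρ c' = (ρ c - ρ x) + (ρ x - ρ c') := by abel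
      rw [e]; exact norm_add_le _ _
    have := hsep c c' hc hc' hne
    linarith
  -- an injective positive enumeration of the centre
  set idx : G → ℕ := fun c => if h : c ∈ S then (S.equivFin ⟨c, h⟩ : ℕ) + 1 else 0 with hidx
  have hidx_inj : ∀ c c' : G, c ∈ S → c' ∈ S → idx c = idx c' → c = c' := by
    intro c c' hc hc' h
    simp only [hidx, hc, hc', dif_pos] at h
    have h' : (S.equivFin ⟨c, hc⟩ : ℕ) = (S.equivFin ⟨c', hc'⟩ : ℕ) := by omega
    have h'' : S.equivFin ⟨c, hc⟩ = S.equivFin ⟨c', hc'⟩ := Fin.ext h'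
    exact congrArg Subtype.val (S.equivFin.injective h'')
  -- the label and the wall
  set O : G → ℕ := fun g => ∑ c ∈ S, if ‖ρ g - ρ c‖ < θ then idx c else 0 with hOdef
  set η : ℝ := θ ^ 2 / 2 with hη
  have hη0 : 0 < η := by positivity
  set W : Set G := {g | ∀ c ∈ Subgroup.center G, η ≤ (r.N : ℝ) - (ρ (c⁻¹ * g)).trace.re} with hWdef
  -- off the wall = θ-close to some central element
  have hdist : ∀ c g : G, (r.N : ℝ) - (ρ (c⁻¹ * g)).trace.re = ‖ρ g - ρ c‖ ^ 2 / 2 := traceDist_eq ρ hU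
  have hclose_iff : ∀ c g : G, (r.N : ℝ) - (ρ (c⁻¹ * g)).trace.re < η ↔ ‖ρ g - ρ c‖ < θ := by
    intro c g
    rw [hdist, hη, div_lt_div_iff_of_pos_right (by norm_num : (0:ℝ) < 2)]
    exact pow_lt_pow_iff_left₀ (norm_nonneg _) hθ0.le two_ne_zero
  have hnotW : ∀ g : G, g ∉ W ↔ ∃ c ∈ Subgroup.center G, ‖ρ g - ρ c‖ < θ := by
    intro g
    simp only [hWdef, Set.mem_setOf_eq, not_forall, not_le, exists_prop]
    exact ⟨fun ⟨c, hc, h⟩ => ⟨c, hc, (hclose_iff c g).mp h⟩, fun ⟨c, hc, h⟩ => ⟨c, hc, (hclose_iff c g).mpr h⟩⟩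
  -- the value of the label off the wall
  have hOval : ∀ (g c₀ : G), c₀ ∈ Subgroup.center G → ‖ρ g - ρ c₀‖ < θ → O g = idx c₀ := by
    intro g c₀ hc₀ hclose
    have hc₀S : c₀ ∈ S := (hS c₀).mpr hc₀
    simp only [hOdef]
    rw [Finset.sum_eq_single c₀]
    · rw [if_pos hclose]
    · intro c hcS hne
      rw [if_neg]
      intro hc
      exact hne (huniq g c c₀ ((hS c).mp hcS) hc₀ (by linarith) (by linarith))
    · intro h; exact absurd hc₀S h
  refine ⟨z, hz, O, fun τ _hτ => ⟨W, η, η, ?_, ?_, ?_, ?_, ?_, hη0, ?_, hη0, ?_⟩⟩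
  · -- `O` is measurable: a finite sum of indicators of open sets
    refine Finset.measurable_sum S fun c _ => Measurable.ite ?_ measurable_const measurable_const
    exact (isOpen_lt (continuous_norm.comp (r.continuous.sub continuous_const)) continuous_const).measurableSet
  · -- `W` is measurable: a finite intersection of closed sets
    have hWeq : W = ⋂ c ∈ (Subgroup.center G : Set G), {g | η ≤ (r.N : ℝ) - (ρ (c⁻¹ * g)).trace.re} := by
      ext g; simp only [hWdef, Set.mem_setOf_eq, Set.mem_iInter, SetLike.mem_coe]
    rw [hWeq]
    refine hSfin.measurableSet_biInter fun c _ => ?_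
    refine (isClosed_le continuous_const ?_).measurableSet
    exact continuous_const.sub (Complex.continuous_re.comp
      (r.continuous.comp (continuous_const.mul continuous_id)).matrix_trace)
  · -- `O` is a class function
    intro g h
    by_cases hg : ∃ c ∈ Subgroup.center G, ‖ρ g - ρ c‖ < θ
    · obtain ⟨c₀, hc₀, hclose⟩ := hg
      have hclose' : ‖ρ (h * g * h⁻¹) - ρ c₀‖ < θ := by rw [norm_rho_conj_sub_central ρ hU c₀ hc₀ g h]; exact hclose
      rw [hOval g c₀ hc₀ hclose, hOval _ c₀ hc₀ hclose']
    · have hg' : ¬ ∃ c ∈ Subgroup.center G, ‖ρ (h * g * h⁻¹) - ρ c‖ < θ := by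
        rintro ⟨c, hc, hcl⟩
        exact hg ⟨c, hc, by rw [← norm_rho_conj_sub_central ρ hU c hc g h]; exact hcl⟩
      have h1 : O g = 0 := by
        simp only [hOdef]
        refine Finset.sum_eq_zero fun c hcS => ?_
        rw [if_neg]
        exact fun hc => hg ⟨c, (hS c).mp hcS, hc⟩
      have h2 : O (h * g * h⁻¹) = 0 := by
        simp only [hOdef]
        refine Finset.sum_eq_zero fun c hcS => ?_
        rw [if_neg]
        exact fun hc => hg' ⟨c, (hS c).mp hcS, hc⟩
      rw [h1, h2]
  · -- `W` is conjugation invariant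
    intro g h
    simp only [hWdef, Set.mem_setOf_eq, hdist]
    constructor
    · intro hw c hc
      have := hw c hc
      rwa [norm_rho_conj_sub_central ρ hU c hc g h] at this
    · intro hw c hc
      rw [norm_rho_conj_sub_central ρ hU c hc g h]
      exact hw c hc
  · -- the label changes under `z` off the wall
    intro g hg
    obtain ⟨c₀, hc₀, hclose⟩ := (hnotW g).mp hg
    have hzc₀ : z * c₀ ∈ Subgroup.center G := Subgroup.mul_mem _ hz hc₀
    have hclose' : ‖ρ (z * g) - ρ (z * c₀)‖ < θ := by rw [norm_rho_mul_sub_mul ρ hU z g c₀]; exact hclose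
    rw [hOval g c₀ hc₀ hclose, hOval (z * g) (z * c₀) hzc₀ hclose']
    intro h
    have := hidx_inj (z * c₀) c₀ ((hS _).mpr hzc₀) ((hS _).mpr hc₀) h
    exact hz1 (mul_right_cancel (a := z) (b := c₀) (c := 1) (by rw [one_mul]; exact this))
  · -- local constancy off the wall at trace scale `δ = η`
    intro g g' hgg' hg hg'
    obtain ⟨c, hc, hcl⟩ := (hnotW g).mp hg
    obtain ⟨c', hc', hcl'⟩ := (hnotW g').mp hg'
    have hclose : ‖ρ g' - ρ g‖ < θ := (hclose_iff g g').mp hgg'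
    have hcc' : c = c' := by
      refine huniq g c c' hc hc' (by linarith) ?_
      calc ‖ρ g - ρ c'‖ = ‖(ρ g - ρ g') + (ρ g' - ρ c')‖ := by rw [sub_add_sub_cancel]
        _ ≤ ‖ρ g - ρ g'‖ + ‖ρ g' - ρ c'‖ := norm_add_le _ _
        _ < θ + θ := by rw [norm_sub_rev]; exact add_lt_add hclose hcl'
        _ = 2 * θ := by ring
    rw [hOval g c hc hcl, hOval g' c' hc' hcl', hcc']
  · -- the wall is `η`-separated from the whole centre
    intro c hc g hg
    exact hg c hc

end Summit.QuantumFields.YangMills.Theorems.CentreWallReflection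

end
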